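import Literature.NumberTheory.CubicFields.PureCubicLexMinProgram
import HarnessLib

/-!
# The program `lexE`: list-level semantics

Topic `NumberTheory/CubicFields`, sub-namespace `PureCubicLexMin`. Symbolic execution of the
register expressions of `PureCubicLexMinProgram.lean` and the shape of the candidate lists (no
number theory here):

* `mem_box` : the box is `{[c₀, c₁, c₂] : |cᵢ| ≤ 40}`;
* `uExprs_map`, `rExprs_eval`, `wExprs_eval`, `nrmW_eval`, `cylW_eval`, `ltW_eval` : closed forms;
* `mem_perScale_iff` (**every candidate is an integer combination of the basis rows**): `w` is a
  candidate at scale `s` iff `w = [p h11, p h12 + q h22, p h13 + q h23 + r h33]` with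
  `(p, q, r) = c' U` for some `c'` in the box (`U` the nine integers the program computed — whatever
  they are);
* `mem_allCands_iff`, `inCyl_eq_true_iff`, `isLt_eq_true_iff`, `mem_validCands_iff`,
  `mem_minCands_iff`, `lexE_eq_of_minCands_eq_cons`.

## References

* H. Cohen, *A Course in Computational Algebraic Number Theory*, GTM 138 (1993), §6.5. [Cohen1993]
-/

namespace Literature.NumberTheory.CubicFields

namespace PureCubicLexMin

open Literature.Computability.Complexity Literature.Computability.Complexity.RegProg PureCubicCodes

/-! ### The box -/

/-- **The enumeration box** is the set of rows `[c₀, c₁, c₂]` with `|cᵢ| ≤ 40`. [folklore] -/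
theorem mem_box (w : List ℤ) :
    w ∈ box ↔ ∃ c0 c1 c2 : ℤ, w = [c0, c1, c2] ∧ |c0| ≤ 40 ∧ |c1| ≤ 40 ∧ |c2| ≤ 40 := by
  have hb : box = (((List.range 81 : List ℕ) : List ℤ)).flatMap fun i : ℤ =>
      ((List.range 81 : List ℕ) : List ℤ).flatMap fun j : ℤ =>
        ((List.range 81 : List ℕ) : List ℤ).map fun k : ℤ => [i - 40, j - 40, k - 40] := rfl
  -- the elementwise coercion of the range is a `map` (cf. `coe_list_eq_map`, `PureCubicLexMinFP.lean`)
  have hcoe : ∀ l : List ℕ, ((l : List ℤ)) = l.map (fun a : ℕ => (a : ℤ)) := by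
    intro l
    induction l with
    | nil => rfl
    | cons a l ih =>
      show (a : ℤ) :: ((l : List ℤ)) = _
      rw [ih, List.map_cons]
  rw [hb, hcoe]
  simp only [List.mem_flatMap, List.mem_map, List.mem_range]
  constructor
  · rintro ⟨i, ⟨i', hi', rfl⟩, j, ⟨j', hj', rfl⟩, k, ⟨k', hk', rfl⟩, rfl⟩
    refine ⟨_, _, _, rfl, ?_, ?_, ?_⟩ <;> rw [abs_le] <;> omega
  · rintro ⟨c0, c1, c2, rfl, h0, h1, h2⟩
    rw [abs_le] at h0 h1 h2
    refine ⟨c0 + 40, ⟨(c0 + 40).toNat, by omega, by omega⟩, c1 + 40, ⟨(c1 + 40).toNat, by omega, by omega⟩,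
      c2 + 40, ⟨(c2 + 40).toNat, by omega, by omega⟩, ?_⟩
    simp only [List.cons.injEq, and_true]
    omega

/-! ### Closed forms of the register expressions -/

/-- The nine values of `uExprs` as a list of nine evaluations. [folklore] -/
theorem uExprs_map (f : Ex → ℤ) :
    uExprs.map f = [f (uEntry 0 0), f (uEntry 0 1), f (uEntry 0 2), f (uEntry 1 0), f (uEntry 1 1),
      f (uEntry 1 2), f (uEntry 2 0), f (uEntry 2 1), f (uEntry 2 2)] := rfl

/-- **`R' = U H`**: the closed form of `rExprs` on `U ++ [h11, …, h33]`. [folklore] -/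
theorem rExprs_eval (u0 u1 u2 u3 u4 u5 u6 u7 u8 h11 h12 h13 h22 h23 h33 : ℤ) :
    rExprs.map (Ex.eval 0 ([u0, u1, u2, u3, u4, u5, u6, u7, u8] ++ [h11, h12, h13, h22, h23, h33])) =
      [u0 * h11, u0 * h12 + u1 * h22, u0 * h13 + u1 * h23 + u2 * h33,
       u3 * h11, u3 * h12 + u4 * h22, u3 * h13 + u4 * h23 + u5 * h33,
       u6 * h11, u6 * h12 + u7 * h22, u6 * h13 + u7 * h23 + u8 * h33] := by
  simp [rExprs, rEntry, hReg, mat, Ex.eval]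

/-- **`w = c' R'`**: the closed form of `wExprs` on `c' ++ R'`. [folklore] -/
theorem wExprs_eval (c0 c1 c2 r0 r1 r2 r3 r4 r5 r6 r7 r8 : ℤ) :
    wExprs.map (Ex.eval 0 ([c0, c1, c2] ++ [r0, r1, r2, r3, r4, r5, r6, r7, r8])) =
      [c0 * r0 + c1 * r3 + c2 * r6, c0 * r1 + c1 * r4 + c2 * r7, c0 * r2 + c1 * r5 + c2 * r8] := by
  simp [wExprs, wEntry, mat, Ex.eval]

/-- **The norm test** `nrmW` evaluates the norm form. [folklore] -/
theorem nrmW_eval (x y z a b den : ℤ) : nrmW.eval 0 [x, y, z, a, b, den] = normRow a b (x, y, z) := by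
  simp [nrmW, normEx, cubeE, Ex.eval, normRow]
  ring

/-- **The cylinder test** `cylW` evaluates `normRow (den² w − (N w, 0, 0))`. [folklore] -/
theorem cylW_eval (x y z a b den : ℤ) :
    cylW.eval 0 [x, y, z, a, b, den] =
      normRow a b (den ^ 2 * x - normRow a b (x, y, z), den ^ 2 * y, den ^ 2 * z) := by
  simp [cylW, nrmW, normEx, cubeE, Ex.eval, normRow]
  ring

/-- **The comparison test** `ltW` evaluates `normRow (w' − w)`. [folklore] -/
theorem ltW_eval (x' y' z' x y z a b : ℤ) :
    ltW.eval 0 ([x', y', z'] ++ [x, y, z] ++ [a, b]) = normRow a b (x' - x, y' - y, z' - z) := by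
  simp [ltW, normEx, cubeE, Ex.eval, normRow]
  ring

/-! ### The candidates at one scale -/

/-- **Every candidate at a scale is an integer combination of the basis rows**, and conversely the
combinations with box coefficients (through the program's matrix `U`) are candidates: with
`U = uExprs.map (eval 0 (B̃ ++ B̃'))`, `w ∈ perScale` iff `w = [p h11, p h12 + q h22,
p h13 + q h23 + r h33]` where `(p, q, r) = (c₀, c₁, c₂) U` for some `[c₀, c₁, c₂]` in the box.
[cite: Cohen1993, §6.5] -/
theorem mem_perScale_iff (a b den : ℕ) (h11 h12 h13 h22 h23 h33 : ℤ) (N : ℕ) (s : ℤ) (w : List ℤ) :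
    let bt := btExprs.map (Ex.eval N (regs0 ((a, b), (den, [h11, h12, h13, h22, h23, h33])) N s))
    let U : ℕ → ℕ → ℤ := fun i j => Ex.eval 0 (bt ++ lll9 bt) (uEntry i j)
    w ∈ perScale ((a, b), (den, [h11, h12, h13, h22, h23, h33])) N s ↔
      ∃ c0 c1 c2 : ℤ, |c0| ≤ 40 ∧ |c1| ≤ 40 ∧ |c2| ≤ 40 ∧
        w = [(c0 * U 0 0 + c1 * U 1 0 + c2 * U 2 0) * h11,
             (c0 * U 0 0 + c1 * U 1 0 + c2 * U 2 0) * h12 + (c0 * U 0 1 + c1 * U 1 1 + c2 * U 2 1) * h22,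
             (c0 * U 0 0 + c1 * U 1 0 + c2 * U 2 0) * h13 + (c0 * U 0 1 + c1 * U 1 1 + c2 * U 2 1) * h23 +
               (c0 * U 0 2 + c1 * U 1 2 + c2 * U 2 2) * h33] := by
  intro bt U
  have hU : uExprs.map (Ex.eval 0 (bt ++ lll9 bt)) =
      [U 0 0, U 0 1, U 0 2, U 1 0, U 1 1, U 1 2, U 2 0, U 2 1, U 2 2] := uExprs_map _
  have hR := rExprs_eval (U 0 0) (U 0 1) (U 0 2) (U 1 0) (U 1 1) (U 1 2) (U 2 0) (U 2 1) (U 2 2)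
    h11 h12 h13 h22 h23 h33
  have hper : perScale ((a, b), (den, [h11, h12, h13, h22, h23, h33])) N s =
      box.map fun c => wExprs.map (Ex.eval 0 (c ++ rExprs.map (Ex.eval 0
        (uExprs.map (Ex.eval 0 (bt ++ lll9 bt)) ++ [h11, h12, h13, h22, h23, h33])))) := rfl
  rw [hper, hU, hR, List.mem_map]
  constructor
  · rintro ⟨c, hc, rfl⟩
    obtain ⟨c0, c1, c2, rfl, h0, h1, h2⟩ := (mem_box c).1 hc
    refine ⟨c0, c1, c2, h0, h1, h2, ?_⟩
    rw [wExprs_eval]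
    simp only [List.cons.injEq, and_true]
    refine ⟨by ring, by ring, by ring⟩
  · rintro ⟨c0, c1, c2, h0, h1, h2, rfl⟩
    refine ⟨[c0, c1, c2], (mem_box _).2 ⟨c0, c1, c2, rfl, h0, h1, h2⟩, ?_⟩
    rw [wExprs_eval]
    simp only [List.cons.injEq, and_true]
    refine ⟨by ring, by ring, by ring⟩

/-- Candidates are rows of three integers. [folklore] -/
theorem length_eq_three_of_mem_perScale {inp : (ℕ × ℕ) × (ℕ × List ℤ)} {N : ℕ} {s : ℤ} {w : List ℤ}
    (hw : w ∈ perScale inp N s) : w.length = 3 := by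
  unfold perScale at hw
  dsimp only at hw
  obtain ⟨c, -, rfl⟩ := List.mem_map.1 hw
  rfl

/-! ### The scan, the filters, the selection -/

/-- **The scan**: `w ∈ allCands` iff `w` is a candidate at some scale `s ∈ [−S, S]` (budget `N`).
[folklore] -/
theorem mem_allCands_iff (inp : (ℕ × ℕ) × (ℕ × List ℤ)) (w : List ℤ) :
    w ∈ allCands inp ↔ ∃ s : ℤ, -(halfWidth inp : ℤ) ≤ s ∧ s ≤ halfWidth inp ∧ w ∈ perScale inp (budget inp) s := by
  have h : allCands inp = (((List.range (2 * halfWidth inp + 1) : List ℕ) : List ℤ).map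
      fun k : ℤ => perScale inp (budget inp) (k - halfWidth inp)).flatten := by
    unfold allCands; rfl
  have hcoe : ∀ l : List ℕ, ((l : List ℤ)) = l.map (fun a : ℕ => (a : ℤ)) := by
    intro l
    induction l with
    | nil => rfl
    | cons a l ih =>
      show (a : ℤ) :: ((l : List ℤ)) = _
      rw [ih, List.map_cons]
  rw [h, hcoe, List.map_map, List.mem_flatten]
  simp only [List.mem_map, List.mem_range, Function.comp_apply]
  constructor
  · rintro ⟨l, ⟨k, hk, rfl⟩, hw⟩
    exact ⟨(k : ℤ) - halfWidth inp, by omega, by omega, hw⟩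
  · rintro ⟨s, hs1, hs2, hw⟩
    refine ⟨_, ⟨(s + halfWidth inp).toNat, by omega, rfl⟩, ?_⟩
    rwa [show (((s + halfWidth inp).toNat : ℕ) : ℤ) - halfWidth inp = s by omega]

/-- Every element of `allCands` is a row of three integers. [folklore] -/
theorem exists_eq_triple_of_mem_allCands {inp : (ℕ × ℕ) × (ℕ × List ℤ)} {w : List ℤ}
    (hw : w ∈ allCands inp) : ∃ x y z : ℤ, w = [x, y, z] := by
  obtain ⟨s, -, -, hs⟩ := (mem_allCands_iff inp w).1 hw
  have hl := length_eq_three_of_mem_perScale hs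
  match w, hl with
  | [x, y, z], _ => exact ⟨x, y, z, rfl⟩

/-- **The cylinder test on a row**: `inCyl ((a, b), (den, hs)) [x, y, z]` iff
`0 < normRow (x, y, z)` and `0 < normRow (den² x − normRow, den² y, den² z)`. [folklore] -/
theorem inCyl_eq_true_iff (a b den : ℕ) (hs : List ℤ) (x y z : ℤ) :
    inCyl ((a, b), (den, hs)) [x, y, z] = true ↔
      0 < normRow a b (x, y, z) ∧
      0 < normRow a b ((den : ℤ) ^ 2 * x - normRow a b (x, y, z), (den : ℤ) ^ 2 * y, (den : ℤ) ^ 2 * z) := by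
  unfold inCyl
  simp only [List.cons_append, List.nil_append, Bool.and_eq_true, decide_eq_true_eq]
  rw [nrmW_eval, cylW_eval]

/-- **The comparison on rows**: `isLt inp [x', y', z'] [x, y, z]` iff `normRow (x' − x, y' − y, z' − z) < 0`.
[folklore] -/
theorem isLt_eq_true_iff (a b den : ℕ) (hs : List ℤ) (x' y' z' x y z : ℤ) :
    isLt ((a, b), (den, hs)) [x', y', z'] [x, y, z] = true ↔ normRow a b (x' - x, y' - y, z' - z) < 0 := by
  unfold isLt
  simp only [decide_eq_true_eq]
  rw [ltW_eval]

/-- Membership in `validCands`. [folklore] -/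
theorem mem_validCands_iff (inp : (ℕ × ℕ) × (ℕ × List ℤ)) (w : List ℤ) :
    w ∈ validCands inp ↔ w ∈ allCands inp ∧ inCyl inp w = true := by
  unfold validCands; exact List.mem_filter

/-- Membership in `minCands`. [folklore] -/
theorem mem_minCands_iff (inp : (ℕ × ℕ) × (ℕ × List ℤ)) (w : List ℤ) :
    w ∈ minCands inp ↔ w ∈ validCands inp ∧ ∀ w' ∈ validCands inp, isLt inp w' w = false := by
  unfold minCands
  rw [List.mem_filter, List.all_eq_true]
  simp only [Bool.not_eq_true']

/-- **The output**: if `minCands = w :: rest` then `lexE = (w₀, w₁, w₂, den)`. [folklore] -/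
theorem lexE_eq_of_minCands_eq_cons {inp : (ℕ × ℕ) × (ℕ × List ℤ)} {w : List ℤ} {rest : List (List ℤ)}
    (h : minCands inp = w :: rest) : lexE inp = (w.getD 0 0, w.getD 1 0, w.getD 2 0, inp.2.1) := by
  unfold lexE
  rw [h]

/-- If `minCands` is nonempty, its head is a member. [folklore] -/
theorem exists_lexE_eq_of_ne_nil {inp : (ℕ × ℕ) × (ℕ × List ℤ)} (h : minCands inp ≠ []) :
    ∃ w ∈ minCands inp, lexE inp = (w.getD 0 0, w.getD 1 0, w.getD 2 0, inp.2.1) := by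
  match hm : minCands inp with
  | [] => exact absurd hm h
  | w :: rest => exact ⟨w, List.mem_cons_self, lexE_eq_of_minCands_eq_cons hm⟩

end PureCubicLexMin

end Literature.NumberTheory.CubicFields
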